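import Summits.Ventures.LatticeQCDFlow.Scaling.HomLadderWilsonFloor
import Summits.Ventures.LatticeQCDFlow.Scaling.FlowLadderConjugacy
import Summits.Ventures.LatticeQCDFlow.Scaling.FlowLadderEquivariantMixingFloor
import Summits.Ventures.LatticeQCDFlow.Scaling.FlowStarMixingCeiling

/-!
HONEST FRAMING: exact (Metropolis-corrected) sampling algorithms for lattice gauge theory; figures
of merit are autocorrelation/cost numbers at stated couplings and volumes; no continuum-physics
claim.

# FlowLadderWilsonFloor — PERFECT ADJACENT TRANSPORTS DO NOT BEAT `K³·log K`: FOR THE MAP-ASSISTED LADDER `ptFlowSampler t μ M φ` WITH `μ_{j+1}∘φ_j = μ_j` (EVERY FLOW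
# SWAP ACCEPTED), ARBITRARY COLD LAWS, AN EXACT HOT SAMPLER AND IDLE COLD KERNELS, **`t_mix(1/4) ≥ (K(2K+1)²/(π²t) − 1)·(½·log(K+1) − log(24√5))`** WHENEVER SOME
# `μ_0(u) ≤ ½` (lean-2 GEN-47, ours)

Venture-side (OURS).  Cell `lqcd-flow` (pub-lqcd), unit `pub-lqcd-lean-2-g47`, 2026-08-31.  Chapter AG, file 4.  Chapter I file 3 (`Scaling/FlowLadderConjugacy`): in level
coordinates `L_0 = 1`, `L_{j+1} = L_j∘φ_j⁻¹` the flow ladder `ptFlowSampler t μ M φ` IS the plain ladder `ptBareSampler t ν^L M^L` for the pulled-back laws `ν^L_i = μ_i∘L_i⁻¹`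
and kernels `M^L_i = L_i M_i L_i⁻¹`, entry by entry under the bijection `x ↦ (L_ix_i)_i`; perfect adjacent transports `μ_{j+1}(φ_ju) = μ_j(u)` make every `ν^L_i = μ_0`.  A
bijective relabelling preserves the distance profile `d(n)` (`worstTvDist_relabel`, chapter I file 11's companion) and hence the mixing time, and it carries the exact hot sampler and
idle cold kernels to an exact hot sampler and idle cold kernels; so chapter AG file 3's floor for the homogeneous `ptBareSampler` transfers verbatim.  No definitions.

* §1 `relabelLadder_hotSampler`, `relabelLadder_idle` (the conjugate kernels), **`flowLadder_worstTvDist_eq`** (the distance profile of the flow ladder is that of the conjugate plain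
  ladder), `flowLadder_mixingTime_eq`.
* §2 **`flowLadderPerfect_mixingTime_ge_of_levelMaps`** (level-coordinate form: `μ_i∘L_i⁻¹ = μ_0` for all `i`), **`flowLadderPerfect_mixingTime_ge`** (adjacent form:
  `μ_{j+1}∘φ_j = μ_j` for all `j`) — **`(K(2K+1)²/(π²t) − 1)·(½·log(K+1) − log(24√5)) ≤ t_mix(1/4)`**, `K ≥ 2`, `0 < t < 1`, `μ_0 > 0` with some `μ_0(u) ≤ ½`.

Reading (no numerics implied): learned bijections between neighbouring levels that transport each law exactly onto the next remove every rejection, and still the ladder needs order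
`(K³/t)·log K` steps from a cold start — the maps change coordinates, not the diffusive transport of content along the ladder (chapter I's «maps act on constants, never on the
power of `K`», now including the logarithm on the floor side).  NOT CLAIMED: imperfect transports (rejections only slow the ladder further, but no monotonicity theorem is typed
here); the ceiling.  Literature grade (cell rule): OWN COROLLARY of AG3 + I3; nothing cited; no new bib keys.
-/

noncomputable section

open Finset Function Real
open Literature.Probability.MarkovChains

namespace Summit.Ventures.LatticeQCDFlow.Scaling

variable {S : Type*} [Fintype S] [DecidableEq S] {K : ℕ} {μ : Fin (K + 1) → S → ℝ} {M : Fin (K + 1) → S → S → ℝ} {t : ℝ}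

section LevelMaps
variable (L : Fin (K + 1) → Equiv.Perm S)

omit [Fintype S] [DecidableEq S] in
/-- The conjugate hot kernel is the exact sampler for `μ_0` when `L_0 = 1`. [ours] -/
theorem relabelLadder_hotSampler (hL0 : L 0 = Equiv.refl S) (hM0 : ∀ u v, M 0 u v = μ 0 v) (u v : S) :
    M 0 ((L 0).symm u) ((L 0).symm v) = μ 0 v := by
  rw [hL0]; exact hM0 u v

omit [Fintype S] [DecidableEq S] in
/-- The conjugate cold kernels are idle when the cold kernels are. [ours] -/
theorem relabelLadder_idle [DecidableEq S] (hidle : ∀ i : Fin K, ∀ u v, M i.succ u v = if v = u then 1 else 0) (i : Fin K) (u v : S) :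
    M i.succ ((L i.succ).symm u) ((L i.succ).symm v) = if v = u then 1 else 0 := by
  rw [hidle]
  exact if_congr (L i.succ).symm.injective.eq_iff rfl rfl

/-- **THE FLOW LADDER'S DISTANCE PROFILE IS THAT OF THE CONJUGATE PLAIN LADDER:** with `φ_j = L_{j+1}⁻¹∘L_j`,
`d_{ptFlowSampler t μ M φ, μ̃}(n) = d_{ptBareSampler t ν^L M^L, ν̃^L}(n)`. [ours] -/
theorem flowLadder_worstTvDist_eq (t : ℝ) (μ : Fin (K + 1) → S → ℝ) (M : Fin (K + 1) → S → S → ℝ) (n : ℕ) :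
    worstTvDist (ptFlowSampler t μ M (fun j : Fin K => (L j.castSucc).trans (L j.succ).symm)) (tensorFun μ) n
      = worstTvDist (ptBareSampler t (fun i u => μ i ((L i).symm u)) (fun i u v => M i ((L i).symm u) ((L i).symm v)))
          (tensorFun (fun i u => μ i ((L i).symm u))) n := by
  have hP : (ptFlowSampler t μ M (fun j : Fin K => (L j.castSucc).trans (L j.succ).symm) : (Fin (K + 1) → S) → (Fin (K + 1) → S) → ℝ)
      = fun a b => ptBareSampler t (fun i u => μ i ((L i).symm u)) (fun i u v => M i ((L i).symm u) ((L i).symm v))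
          (Equiv.piCongrRight L a) (Equiv.piCongrRight L b) := by
    funext a b; exact ptFlowSampler_eq_conj L t μ M a b
  have hπ : tensorFun μ = fun a => tensorFun (fun i u => μ i ((L i).symm u)) (Equiv.piCongrRight L a) := by
    funext a; exact tensorFun_relabel L μ a
  rw [hP, hπ]
  exact worstTvDist_relabel (Equiv.piCongrRight L) _ _ n

/-- The flow ladder and its conjugate plain ladder have the same mixing times. [ours] -/
theorem flowLadder_mixingTime_eq (t : ℝ) (μ : Fin (K + 1) → S → ℝ) (M : Fin (K + 1) → S → S → ℝ) (ε : ℝ) :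
    mixingTime (ptFlowSampler t μ M (fun j : Fin K => (L j.castSucc).trans (L j.succ).symm)) (tensorFun μ) ε
      = mixingTime (ptBareSampler t (fun i u => μ i ((L i).symm u)) (fun i u v => M i ((L i).symm u) ((L i).symm v)))
          (tensorFun (fun i u => μ i ((L i).symm u))) ε :=
  mixingTime_congr_of_worstTvDist (flowLadder_worstTvDist_eq L t μ M) ε

/-- **THE FLOOR IN LEVEL COORDINATES:** `L_0 = 1`, `μ_i∘L_i⁻¹ = μ_0` for every level (perfect composed transports), `μ_0 > 0` a probability vector with some `μ_0(u) ≤ ½`, exact hot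
sampler, idle cold kernels, `K ≥ 2`, `0 < t < 1` ⇒ **`(K(2K+1)²/(π²t) − 1)·(½·log(K+1) − log(24√5)) ≤ t_mix(ptFlowSampler t μ M φ^L; 1/4)`**. [ours] -/
theorem flowLadderPerfect_mixingTime_ge_of_levelMaps (hL0 : L 0 = Equiv.refl S) (hK : 2 ≤ K) (hμ0 : ∀ v, 0 < μ 0 v) (hμ01 : ∑ v, μ 0 v = 1)
    (hM0 : ∀ u v, M 0 u v = μ 0 v) (hidle : ∀ i : Fin K, ∀ u v, M i.succ u v = if v = u then 1 else 0) (ht0 : 0 < t) (ht1 : t < 1)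
    (hperf : ∀ (i : Fin (K + 1)) (u : S), μ i ((L i).symm u) = μ 0 u) (u : S) (hu : μ 0 u ≤ 1 / 2) :
    ((K : ℝ) * (2 * K + 1) ^ 2 / (π ^ 2 * t) - 1) * (Real.log ((K : ℝ) + 1) / 2 - Real.log (24 * Real.sqrt 5))
      ≤ (mixingTime (ptFlowSampler t μ M (fun j : Fin K => (L j.castSucc).trans (L j.succ).symm)) (tensorFun μ) (1 / 4) : ℝ) := by
  rw [flowLadder_mixingTime_eq L t μ M]
  have hν : (fun (i : Fin (K + 1)) (u : S) => μ i ((L i).symm u)) = fun _ : Fin (K + 1) => μ 0 := funext fun i => funext fun u => hperf i u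
  rw [hν]
  exact ptBareSampler_hom_mixingTime_ge (M := fun i u v => M i ((L i).symm u) ((L i).symm v)) hK hμ0 hμ01
    (relabelLadder_hotSampler L hL0 hM0) (relabelLadder_idle L hidle) ht0 ht1 u hu

end LevelMaps

/-- **PERFECT ADJACENT TRANSPORTS DO NOT BEAT `K³·log K`:** maps with `μ_{j+1}(φ_ju) = μ_j(u)` for all `j, u` (every flow swap accepted), arbitrary cold laws, `μ_0 > 0` a probability
vector with some `μ_0(u) ≤ ½`, exact hot sampler `M_0(u,·) = μ_0`, idle cold kernels, `K ≥ 2`, `0 < t < 1` ⇒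
**`(K(2K+1)²/(π²t) − 1)·(½·log(K+1) − log(24√5)) ≤ t_mix(ptFlowSampler t μ M φ; 1/4)`**. [ours] -/
theorem flowLadderPerfect_mixingTime_ge (φ : Fin K → Equiv.Perm S) (hK : 2 ≤ K) (hμ0 : ∀ v, 0 < μ 0 v) (hμ01 : ∑ v, μ 0 v = 1)
    (hM0 : ∀ u v, M 0 u v = μ 0 v) (hidle : ∀ i : Fin K, ∀ u v, M i.succ u v = if v = u then 1 else 0) (ht0 : 0 < t) (ht1 : t < 1)
    (hperfect : ∀ (j : Fin K) (u : S), μ j.succ (φ j u) = μ j.castSucc u) (u : S) (hu : μ 0 u ≤ 1 / 2) :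
    ((K : ℝ) * (2 * K + 1) ^ 2 / (π ^ 2 * t) - 1) * (Real.log ((K : ℝ) + 1) / 2 - Real.log (24 * Real.sqrt 5))
      ≤ (mixingTime (ptFlowSampler t μ M φ) (tensorFun μ) (1 / 4) : ℝ) := by
  obtain ⟨L, hL0, hLφ⟩ := exists_levelMaps φ
  have hφ : φ = fun j : Fin K => (L j.castSucc).trans (L j.succ).symm := (funext hLφ).symm
  have hstep : ∀ (j : Fin K) (u : S), (L j.succ).symm u = φ j ((L j.castSucc).symm u) := by
    intro j u
    have h := Equiv.ext_iff.mp (hLφ j) ((L j.castSucc).symm u)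
    simp only [Equiv.trans_apply, Equiv.apply_symm_apply] at h
    exact h
  have hperf : ∀ (i : Fin (K + 1)) (u : S), μ i ((L i).symm u) = μ 0 u := by
    intro i
    induction i using Fin.induction with
    | zero => intro u; rw [hL0]; rfl
    | succ j ih => intro u; rw [hstep j u, hperfect j, ih]
  rw [hφ]
  exact flowLadderPerfect_mixingTime_ge_of_levelMaps L hL0 hK hμ0 hμ01 hM0 hidle ht0 ht1 hperf u hu

end Summit.Ventures.LatticeQCDFlow.Scaling

end
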